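import Summits.QuantumFields.BalabanUV.T4Continuum.Support.NE7NearFlatSharpPrep
import HarnessLib

/-!
# NE7NearFlatSharpAbelian — THE TRIANGLE-WAVE ABELIAN DATUM: `γ`-small, `N`-periodic, `U(n)`-valued, bondwise within `N·γ∕2` of the trivial flat datum, yet at
# bondwise distance `≥ N·γ∕(8π)` from EVERY flat `U(n)`-valued configuration modulo EVERY unitary gauge («almost flat ⇒ near flat» has rate EXACTLY `≍ N·γ`)

Cell `pub-balaban`, rung (B)+1 sub-cell t4, lineage `b2b-balaban-t4-ne7b-p1` (row NE7b OWNER + CRUX PROVER), generation 157; junction census for the NE7 road's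
located gap (G1) of `t4/b2b-balaban-t4-ne7-p1-g113/ROAD-G113.md` §6 («the bondwise distance of a γ-small datum to the flat data is ≍ N·γ at best», located at F29
`NE7SoftDataPath.exists_flat_near`).  Part 2 of 3 (part 1 `NE7NearFlatSharpPrep`: the loop letter; part 3 `NE7NearFlatSharpHolonomy`: the nonlinear witness).
THE WITNESS ([folklore]).  `N ≥ 2`, `m = ⌊N∕2⌋`, `γ ≥ 0`, the `N`-periodic triangle wave `a(j) = m − |j mod N − m|` (`a(0) = 0`, `a(m) = m`, `|a(j+1) − a(j)| ≤ 1`,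
`|a| ≤ m`); `U(x, 0) = D(e^{iγ·a(x₁)})`, `U(x, μ) = 1` for `μ ≠ 0` (`D(z) = diag(1, …, z, …, 1)`).  Plaquette phase sums are `±γ·(a(x₁+1) − a(x₁))` or `0`
(`SmallField U γ`); bonds are within `γ·m ≤ N·γ∕2` of `1`; the rectangle `[0, m e₀] × [0, m e₁]` has holonomy `D(e^{−iγm²})`, `≥ (2∕π)γm²` from `1` when `γm² ≤ π`;
the loop letter (perimeter `4m`) then forces `ρ ≥ γm∕(2π) ≥ Nγ∕(8π)` for any flat `F` and unitary gauge `u` with `‖U^u − F‖ ≤ ρ` bondwise.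
WHAT ([folklore]; 0 def, 0 sorry; profile and configuration enter through EQUATIONAL HYPOTHESES `ha`, `hθ0`, `hθ`, `hU`, instantiated in §4).  §1 the profile
(`triangle_periodic∕_zero∕_mid∕_step`, `abs_triangle_le`); §2 the phases (`abs_plaqPhase_le_of_profile`, `phase_periodic_of_profile`, `abs_phase_le_of_profile`);
§3 the configuration (`isPeriodicCfg_of_profile`, `smallField_of_profile`, `norm_bond_sub_one_le_of_profile`, `phaseMat_pow`, `norm_sub_one_le_norm_phaseMat_sub_one`,
**`val_hol_rectangle_of_profile`** `= D(e^{−iγm²})`, `norm_hol_rectangle_sub_one_ge`); §4 **`exists_smallField_far_from_flat`** — for `N ≥ 2`, `0 ≤ γ`, `N²γ ≤ 4π`: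
a `U(n)`-valued `N`-periodic `V`, `SmallField V γ`, `‖V(b) − 1‖ ≤ (N∕2)γ` at every bond, such that for EVERY flat `U(n)`-valued `F` (periodic or not), EVERY
unitary site field `u` (periodic or not) and every `ρ` with `‖V^u(b) − F(b)‖ ≤ ρ` at all bonds: `Nγ∕(8π) ≤ ρ` (part 3 reads this in F29's currency: `γ(ε′, N) ≤ 8π·ε′∕N`).
HONEST FRAMING (page 1): an explicit lattice configuration and elementary matrix algebra; a statement about the MECHANISM «distance to flat data» of F29 only —
the witness `V = exp(iγ·a·E_{i₀i₀})` lies on the abelian PATH `τ ↦ exp(iτγ·a·E)` of `τγ`-small data from the trivial datum, so it does NOT obstruct the continuity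
method along small-curvature paths (F28 `oneStep_of_path_ape_repWgauge`); F29, the road's ENDs and `hsector` are untouched; nothing of Bałaban's asserted;
NE3∕NE7 NOT proved; row NE7b (`T4WeightBudget.RelWeightBound`) NOT PRINTED ∕ NOT PROVED; spine count = dagwriter's call; finite T⁴ rung (B)+1 — NOT infinite
volume, NOT mass gap, NOT BetaPertH, NOT Clay (continuum YM on T⁴ ⇐ BetaPertH ∧ nine spine estimates).
-/

set_option autoImplicit false

open scoped BigOperators Matrix Matrix.Norms.L2Operator
open Finset NormedSpace Complex

namespace Summit.QuantumFields.BalabanUV.T4Continuum.NE7NearFlatSharpAbelian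

open Literature.MathematicalPhysics.QuantumFieldTheory.Balaban1983to89
open B7Prop1Explicit B7Prop2Explicit
open T4AveragingDeficitWall hiding Site Plane Plaq Bond
open T4AveragingDeficitWallBoundary (IsPeriodicCfg)
open NE3EnergyShapes (IsUnitarySite IsPeriodicSite)
open TorusSmallFieldGlobalGaugeSharpPrep
open NE7NearFlatSharpPrep

noncomputable section

variable {n : Type*} [Fintype n] [DecidableEq n]

/-! ## §1 The `N`-periodic triangle wave `a(j) = m − |j mod N − m|`, `m = ⌊N∕2⌋` -/

section Profile

variable {N : ℕ} {a : ℤ → ℤ} (ha : ∀ j : ℤ, a j = ((N / 2 : ℕ) : ℤ) - |j % (N : ℤ) - ((N / 2 : ℕ) : ℤ)|)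
include ha

/-- The triangle wave is `N`-periodic. [folklore] -/
theorem triangle_periodic (j : ℤ) : a (j + (N : ℤ)) = a j := by
  rw [ha, ha, Int.add_emod_right]

/-- `a(0) = 0`. [folklore] -/
theorem triangle_zero : a 0 = 0 := by
  rw [ha, Int.zero_emod, zero_sub, abs_neg, abs_of_nonneg (by positivity), sub_self]

/-- `a(m) = m` for `N ≥ 2` (`0 ≤ m < N`). [folklore] -/
theorem triangle_mid (hN : 2 ≤ N) : a ((N / 2 : ℕ) : ℤ) = ((N / 2 : ℕ) : ℤ) := by
  have h1 : (((N / 2 : ℕ) : ℤ)) % (N : ℤ) = ((N / 2 : ℕ) : ℤ) := by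
    apply Int.emod_eq_of_lt (by positivity)
    exact_mod_cast Nat.div_lt_self (by omega) (by norm_num)
  rw [ha, h1, sub_self, abs_zero, sub_zero]

/-- `|a(j)| ≤ m` (indeed `0 ≤ a ≤ m`). [folklore] -/
theorem abs_triangle_le (hN : 1 ≤ N) (j : ℤ) : |a j| ≤ ((N / 2 : ℕ) : ℤ) := by
  have hN0 : (0 : ℤ) < (N : ℤ) := by exact_mod_cast hN
  have hr0 : 0 ≤ j % (N : ℤ) := Int.emod_nonneg _ hN0.ne'
  have hr1 : j % (N : ℤ) < (N : ℤ) := Int.emod_lt_of_pos _ hN0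
  have hm : (N : ℤ) ≤ 2 * ((N / 2 : ℕ) : ℤ) + 1 := by
    have := Nat.lt_succ_of_le (Nat.div_mul_le_self N 2)
    omega
  rw [ha, abs_le]
  constructor
  · have : |j % (N : ℤ) - ((N / 2 : ℕ) : ℤ)| ≤ ((N / 2 : ℕ) : ℤ) + ((N / 2 : ℕ) : ℤ) := by
      rw [abs_le]; constructor <;> omega
    linarith
  · linarith [abs_nonneg (j % (N : ℤ) - ((N / 2 : ℕ) : ℤ))]

/-- Consecutive values differ by at most `1` (inside a period `|·|` is `1`-Lipschitz; across the wrap `a(N−1) ∈ {0, 1}` and `a(0) = 0`). [folklore] -/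
theorem triangle_step (hN : 1 ≤ N) (j : ℤ) : |a (j + 1) - a j| ≤ 1 := by
  have hN0 : (0 : ℤ) < (N : ℤ) := by exact_mod_cast hN
  set r := j % (N : ℤ) with hr
  set m : ℤ := ((N / 2 : ℕ) : ℤ) with hmdef
  have hr0 : 0 ≤ r := Int.emod_nonneg _ hN0.ne'
  have hr1 : r < (N : ℤ) := Int.emod_lt_of_pos _ hN0
  have hm : (N : ℤ) ≤ 2 * m + 1 ∧ 2 * m ≤ (N : ℤ) := by
    have h1 := Nat.lt_succ_of_le (Nat.div_mul_le_self N 2)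
    have h2 := Nat.div_mul_le_self N 2
    constructor <;> omega
  have hstep : (j + 1) % (N : ℤ) = (r + 1) % (N : ℤ) := by
    rw [hr, Int.emod_add_emod]
  rw [ha, ha, ← hr, hstep]
  rcases lt_or_eq_of_le (Int.add_one_le_iff.mpr hr1) with hlt | heq
  · -- inside a period
    rw [Int.emod_eq_of_lt (by omega) hlt]
    have := abs_abs_sub_abs_le (r + 1 - m) (r - m)
    rw [show r + 1 - m - (r - m) = 1 by ring, abs_one] at this
    rw [show m - |r + 1 - m| - (m - |r - m|) = -(|r + 1 - m| - |r - m|) by ring, abs_neg]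
    exact this
  · -- across the wrap: `r = N − 1`
    have hm0 : 0 ≤ m := by rw [hmdef]; positivity
    rw [heq, Int.emod_self, zero_sub, abs_neg, abs_of_nonneg hm0, sub_self, zero_sub, abs_neg]
    have hr' : r = (N : ℤ) - 1 := by omega
    rw [hr', abs_le]
    constructor
    · have : |(N : ℤ) - 1 - m| ≤ m := by rw [abs_le]; constructor <;> omega
      linarith
    · have : m - 1 ≤ |(N : ℤ) - 1 - m| := by
        rcases hm with ⟨h1, h2⟩
        rcases le_or_gt 0 ((N : ℤ) - 1 - m) with h | h
        · rw [abs_of_nonneg h]; omega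
        · rw [abs_of_neg h]; omega
      linarith

end Profile

/-! ## §2 The phases `θ(x, 0) = γ·a(x₁)`, `θ(x, μ) = 0` (`μ ≠ 0`) -/

section Phases

variable {N : ℕ} {a : ℤ → ℤ} {γ : ℝ} {θ : Site 4 → Fin 4 → ℝ}
  (hθ0 : ∀ x : Site 4, θ x 0 = γ * ((a (x 1) : ℤ) : ℝ)) (hθ : ∀ (x : Site 4) (μ : Fin 4), μ ≠ 0 → θ x μ = 0)
include hθ0 hθ

/-- THE PLAQUETTE PHASE SUMS ARE `±γ·(a(x₁+1) − a(x₁))` OR `0`, hence at most `γ` in absolute value. [folklore] -/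
theorem abs_plaqPhase_le_of_profile (hγ : 0 ≤ γ) (hstep : ∀ j : ℤ, |a (j + 1) - a j| ≤ 1) (x : Site 4) (κ μ : Fin 4) (hκμ : κ ≠ μ) :
    |θ x κ + θ (x + e κ) μ - θ (x + e μ) κ - θ x μ| ≤ γ := by
  have hst : |((a (x 1 + 1) : ℤ) : ℝ) - ((a (x 1) : ℤ) : ℝ)| ≤ 1 := by exact_mod_cast hstep (x 1)
  have key : ∀ ν : Fin 4, ν ≠ 0 →
      |θ x 0 + θ (x + e 0) ν - θ (x + e ν) 0 - θ x ν| ≤ γ ∧ |θ x ν + θ (x + e ν) 0 - θ (x + e 0) ν - θ x 0| ≤ γ := by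
    intro ν hν
    rw [hθ x ν hν, hθ (x + e 0) ν hν, hθ0 x, hθ0 (x + e ν), add_e_apply]
    by_cases h1 : (1 : Fin 4) = ν
    · subst h1
      simp only [if_true]
      constructor
      · rw [show γ * ((a (x 1) : ℤ) : ℝ) + 0 - γ * ((a (x 1 + 1) : ℤ) : ℝ) - 0 = -(γ * (((a (x 1 + 1) : ℤ) : ℝ) - ((a (x 1) : ℤ) : ℝ))) by ring,
          abs_neg, abs_mul, abs_of_nonneg hγ]
        exact (mul_le_mul_of_nonneg_left hst hγ).trans (by rw [mul_one])
      · rw [show (0 : ℝ) + γ * ((a (x 1 + 1) : ℤ) : ℝ) - 0 - γ * ((a (x 1) : ℤ) : ℝ) = γ * (((a (x 1 + 1) : ℤ) : ℝ) - ((a (x 1) : ℤ) : ℝ)) by ring,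
          abs_mul, abs_of_nonneg hγ]
        exact (mul_le_mul_of_nonneg_left hst hγ).trans (by rw [mul_one])
    · simp only [if_neg h1, add_zero]
      constructor <;> norm_num <;> exact hγ
  by_cases hκ : κ = 0
  · subst hκ
    exact (key μ (Ne.symm hκμ)).1
  by_cases hμ : μ = 0
  · subst hμ
    exact (key κ hκ).2
  · rw [hθ x κ hκ, hθ _ μ hμ, hθ _ κ hκ, hθ x μ hμ]
    norm_num
    exact hγ

/-- THE PHASES ARE `N`-PERIODIC. [folklore] -/
theorem phase_periodic_of_profile (hper : ∀ j : ℤ, a (j + (N : ℤ)) = a j) (x : Site 4) (κ μ : Fin 4) : θ (x + (N : ℤ) • e κ) μ = θ x μ := by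
  by_cases hμ : μ = 0
  · subst hμ
    rw [hθ0, hθ0, add_zsmul_e_apply]
    by_cases h1 : (1 : Fin 4) = κ
    · rw [if_pos h1, hper]
    · rw [if_neg h1, add_zero]
  · rw [hθ _ μ hμ, hθ x μ hμ]

/-- THE PHASES ARE AT MOST `γ·m` IN ABSOLUTE VALUE. [folklore] -/
theorem abs_phase_le_of_profile (hγ : 0 ≤ γ) (hbd : ∀ j : ℤ, |a j| ≤ ((N / 2 : ℕ) : ℤ)) (x : Site 4) (μ : Fin 4) :
    |θ x μ| ≤ γ * ((N / 2 : ℕ) : ℝ) := by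
  by_cases hμ : μ = 0
  · subst hμ
    rw [hθ0, abs_mul, abs_of_nonneg hγ]
    refine mul_le_mul_of_nonneg_left ?_ hγ
    have h2 : (((|a (x 1)| : ℤ)) : ℝ) ≤ (((N / 2 : ℕ) : ℤ) : ℝ) := by exact_mod_cast hbd (x 1)
    rw [Int.cast_abs, Int.cast_natCast] at h2
    exact h2
  · rw [hθ x μ hμ, abs_zero]; positivity

end Phases

/-! ## §3 The configuration `U(x, μ) = D(e^{iθ(x,μ)})`: periodic, `γ`-small, within `γ·m` of `1`, and the rectangle holonomy `D(e^{−iγm²})` -/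

section Cfg

/-- Powers of the one-entry phase matrices: `D(z)^k = D(z^k)`. [folklore] -/
theorem phaseMat_pow (i₀ : n) (z : ℂ) : ∀ k : ℕ,
    (Matrix.diagonal (Function.update (1 : n → ℂ) i₀ z)) ^ k = Matrix.diagonal (Function.update (1 : n → ℂ) i₀ (z ^ k))
  | 0 => by rw [pow_zero, pow_zero, phaseMat_one]
  | k + 1 => by rw [pow_succ, phaseMat_pow i₀ z k, phaseMat_mul, ← pow_succ]

/-- The `(i₀, i₀)` entry bounds the operator norm from below: `‖z − 1‖ ≤ ‖D(z) − 1‖`. [folklore] -/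
theorem norm_sub_one_le_norm_phaseMat_sub_one (i₀ : n) (z : ℂ) : ‖z - 1‖ ≤ ‖Matrix.diagonal (Function.update (1 : n → ℂ) i₀ z) - 1‖ := by
  rw [← phaseMat_one i₀, Matrix.diagonal_sub, Matrix.l2_opNorm_diagonal]
  refine le_trans (le_of_eq ?_) (norm_le_pi_norm _ i₀)
  simp

variable {N : ℕ} {a : ℤ → ℤ} {γ : ℝ} {θ : Site 4 → Fin 4 → ℝ}
  (hθ0 : ∀ x : Site 4, θ x 0 = γ * ((a (x 1) : ℤ) : ℝ)) (hθ : ∀ (x : Site 4) (μ : Fin 4), μ ≠ 0 → θ x μ = 0)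
  {i₀ : n} {U : Site 4 → Fin 4 → (Matrix n n ℂ)ˣ}
  (hU : ∀ x μ, ((U x μ : (Matrix n n ℂ)ˣ) : Matrix n n ℂ) = Matrix.diagonal (Function.update (1 : n → ℂ) i₀ (cexp (I * θ x μ))))
include hθ0 hθ hU

/-- THE CONFIGURATION IS `N`-PERIODIC. [folklore] -/
theorem isPeriodicCfg_of_profile (hper : ∀ j : ℤ, a (j + (N : ℤ)) = a j) : IsPeriodicCfg U (N : ℤ) := by
  intro x κ μ
  apply Units.ext
  rw [hU, hU, phase_periodic_of_profile hθ0 hθ hper]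

/-- THE CONFIGURATION IS SMALL-FIELD WITH RADIUS `γ`. [folklore] -/
theorem smallField_of_profile (hγ : 0 ≤ γ) (hstep : ∀ j : ℤ, |a (j + 1) - a j| ≤ 1) : SmallField U γ :=
  smallField_of_phaseCfg hU (abs_plaqPhase_le_of_profile hθ0 hθ hγ hstep)

/-- EVERY BOND IS WITHIN `γ·m` OF `1` (the configuration is bondwise near the TRIVIAL flat datum, no gauge needed). [folklore] -/
theorem norm_bond_sub_one_le_of_profile (hγ : 0 ≤ γ) (hbd : ∀ j : ℤ, |a j| ≤ ((N / 2 : ℕ) : ℤ)) (x : Site 4) (μ : Fin 4) :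
    ‖((U x μ : (Matrix n n ℂ)ˣ) : Matrix n n ℂ) - 1‖ ≤ γ * ((N / 2 : ℕ) : ℝ) := by
  rw [hU]
  refine (norm_phaseMat_sub_one_le i₀ _).trans ((Real.norm_exp_I_mul_ofReal_sub_one_le).trans ?_)
  rw [Real.norm_eq_abs]
  exact abs_phase_le_of_profile hθ0 hθ hγ hbd x μ

omit hθ0 in
/-- Bonds in directions `μ ≠ 0` are trivial. [folklore] -/
theorem bond_eq_one_of_ne (x : Site 4) {μ : Fin 4} (hμ : μ ≠ 0) : U x μ = 1 := by
  apply Units.ext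
  rw [hU, hθ x μ hμ, Units.val_one]
  simp

omit hθ in
/-- Direction-`0` bonds depend on `x₁` only. [folklore] -/
theorem bond_zero_eq_of_apply_one_eq {x y : Site 4} (h : x 1 = y 1) : U x 0 = U y 0 := by
  apply Units.ext
  rw [hU, hU, hθ0, hθ0, h]

/-- **THE RECTANGLE HOLONOMY**: along `∂([0, m e₀] × [0, m e₁])` from `0` (first `e₀`, then `e₁`), `U(∂R) = D(e^{−iγ·a(m)·m})·D(e^{iγ·a(0)·m})⁻¹…` — with
`a(0) = 0`, `a(m) = m`: `U(∂R) = D(e^{−iγm²})` (the two `e₁`-sides are trivial, the lower `e₀`-side carries `a(0) = 0`, the upper one `a(m) = m`, traversed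
backwards). [folklore] -/
theorem val_hol_rectangle_of_profile (h0 : a 0 = 0) (hmid : a ((N / 2 : ℕ) : ℤ) = ((N / 2 : ℕ) : ℤ)) :
    ((hol U 0 (List.replicate (N / 2) ((0 : Fin 4), true) ++ List.replicate (N / 2) ((1 : Fin 4), true)
        ++ List.replicate (N / 2) ((0 : Fin 4), false) ++ List.replicate (N / 2) ((1 : Fin 4), false)) : (Matrix n n ℂ)ˣ) : Matrix n n ℂ)
      = Matrix.diagonal (Function.update (1 : n → ℂ) i₀ (cexp (-(I * (γ * ((N / 2 : ℕ) : ℝ) * ((N / 2 : ℕ) : ℝ)))))) := by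
  set m : ℕ := N / 2 with hm
  -- the four sides
  have s1 : hol U 0 (List.replicate m ((0 : Fin 4), true)) = 1 := by
    rw [hol_replicate_true_of_eq U 0 1 m 0 fun j _ => ?_, one_pow]
    apply Units.ext
    rw [hU, Units.val_one, hθ0]
    have : ((0 : Site 4) + (j : ℤ) • e (0 : Fin 4)) 1 = 0 := by rw [add_zsmul_e_apply]; simp
    rw [this, h0]
    simp
  have s2 : hol U ((m : ℤ) • e (0 : Fin 4)) (List.replicate m ((1 : Fin 4), true)) = 1 := by
    rw [hol_replicate_true_of_eq U 1 1 m _ fun j _ => bond_eq_one_of_ne hθ hU _ one_ne_zero, one_pow]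
  have s3 : hol U ((m : ℤ) • e (0 : Fin 4) + (m : ℤ) • e (1 : Fin 4)) (List.replicate m ((0 : Fin 4), false))
      = (U ((m : ℤ) • e (1 : Fin 4)) 0)⁻¹ ^ m := by
    refine hol_replicate_false_of_eq U 0 (U ((m : ℤ) • e (1 : Fin 4)) 0) m _ fun j _ => ?_
    refine bond_zero_eq_of_apply_one_eq hθ0 hU ?_
    simp [sub_eq_add_neg, e_apply]
  have s4 : hol U ((m : ℤ) • e (1 : Fin 4)) (List.replicate m ((1 : Fin 4), false)) = 1 := by
    rw [hol_replicate_false_of_eq U 1 1 m _ fun j _ => bond_eq_one_of_ne hθ hU _ one_ne_zero, inv_one, one_pow]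
  rw [hol_append, hol_append, hol_append]
  simp only [disp_append, disp_replicate, Letter.vec_true, Letter.vec_false, zero_add, smul_neg]
  rw [s1, s2, s3, show ((m : ℕ) : ℤ) • e (0 : Fin 4) + ((m : ℕ) : ℤ) • e (1 : Fin 4) + -(((m : ℕ) : ℤ) • e (0 : Fin 4)) = ((m : ℕ) : ℤ) • e (1 : Fin 4) by abel,
    s4, one_mul, one_mul, mul_one, Units.val_pow_eq_pow_val, val_inv_of_phaseCfg hU, phaseMat_pow, hθ0]
  congr 2
  have h1 : (((m : ℕ) : ℤ) • e (1 : Fin 4) : Site 4) 1 = (m : ℤ) := by simp [e_apply]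
  rw [h1, hmid, ← Complex.exp_nat_mul]
  congr 1
  push_cast
  ring

/-- **THE RECTANGLE HOLONOMY IS FAR FROM `1`**: `‖U(∂R) − 1‖ ≥ (2∕π)·γ·m²` when `0 ≤ γ` and `γ·m² ≤ π` (`|e^{−is} − 1| = 2 sin(s∕2) ≥ (2∕π)s` on `[0, π]`).
[folklore] -/
theorem norm_hol_rectangle_sub_one_ge (h0 : a 0 = 0) (hmid : a ((N / 2 : ℕ) : ℤ) = ((N / 2 : ℕ) : ℤ)) (hγ : 0 ≤ γ)
    (hγm : γ * ((N / 2 : ℕ) : ℝ) * ((N / 2 : ℕ) : ℝ) ≤ Real.pi) :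
    2 / Real.pi * (γ * ((N / 2 : ℕ) : ℝ) * ((N / 2 : ℕ) : ℝ)) ≤
      ‖((hol U 0 (List.replicate (N / 2) ((0 : Fin 4), true) ++ List.replicate (N / 2) ((1 : Fin 4), true)
        ++ List.replicate (N / 2) ((0 : Fin 4), false) ++ List.replicate (N / 2) ((1 : Fin 4), false)) : (Matrix n n ℂ)ˣ) : Matrix n n ℂ) - 1‖ := by
  rw [val_hol_rectangle_of_profile hθ0 hθ hU h0 hmid]
  refine le_trans ?_ (norm_sub_one_le_norm_phaseMat_sub_one i₀ _)
  set s : ℝ := γ * ((N / 2 : ℕ) : ℝ) * ((N / 2 : ℕ) : ℝ) with hs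
  have hs0 : 0 ≤ s := by positivity
  have e1 : -(I * (s : ℂ)) = I * ((-s : ℝ) : ℂ) := by push_cast; ring
  have e2 : (I * (γ * ((N / 2 : ℕ) : ℝ) * ((N / 2 : ℕ) : ℝ)) : ℂ) = I * (s : ℂ) := by rw [hs]; push_cast; ring
  rw [e2, e1, Complex.norm_exp_I_mul_ofReal_sub_one]
  rw [Real.norm_eq_abs, abs_mul, abs_two, neg_div, Real.sin_neg, abs_neg]
  have hsin : 2 / Real.pi * (s / 2) ≤ Real.sin (s / 2) := Real.mul_le_sin (by positivity) (by linarith)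
  have hsin0 : 0 ≤ Real.sin (s / 2) := le_trans (by positivity) hsin
  rw [abs_of_nonneg hsin0]
  linarith

end Cfg

/-! ## §4 THE WITNESS ASSEMBLED: `γ`-small, within `N·γ∕2` of the trivial datum, `≥ N·γ∕(8π)` from every flat datum modulo every unitary gauge -/

section Witness

variable [Nonempty n]

/-- **A `γ`-SMALL DATUM AT DISTANCE EXACTLY `≍ N·γ` FROM THE FLAT DATA MODULO GAUGE.**  For `N ≥ 2`, `0 ≤ γ` and `N²γ ≤ 4π` there is a `U(n)`-valued `N`-periodic
configuration `V` on `ℤ⁴` with `SmallField V γ` and every bond within `(N∕2)·γ` of `1` such that: for EVERY `U(n)`-valued configuration `F` with all plaquette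
variables `1` (periodic or not) and EVERY unitary site field `u` (periodic or not), if `‖V^u(b) − F(b)‖ ≤ ρ` at every bond then `N·γ∕(8π) ≤ ρ`.  (The
triangle-wave configuration of §3 at `m = ⌊N∕2⌋`; the loop letter of part 1 on the rectangle `[0, me₀] × [0, me₁]` of perimeter `4m`.) [folklore] -/
theorem exists_smallField_far_from_flat {N : ℕ} (hN : 2 ≤ N) {γ : ℝ} (hγ : 0 ≤ γ) (hγN : (N : ℝ) ^ 2 * γ ≤ 4 * Real.pi) :
    ∃ V : Site 4 → Fin 4 → (Matrix n n ℂ)ˣ, IsUnitaryCfg V ∧ IsPeriodicCfg V (N : ℤ) ∧ SmallField V γ ∧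
      (∀ (x : Site 4) (κ : Fin 4), ‖((V x κ : (Matrix n n ℂ)ˣ) : Matrix n n ℂ) - 1‖ ≤ (N : ℝ) / 2 * γ) ∧
      ∀ F : Site 4 → Fin 4 → (Matrix n n ℂ)ˣ, IsUnitaryCfg F → (∀ (x : Site 4) (κ μ : Fin 4), κ ≠ μ → hol F x (plaqWord κ μ) = 1) →
        ∀ u : Site 4 → (Matrix n n ℂ)ˣ, IsUnitarySite u → ∀ ρ : ℝ,
          (∀ (x : Site 4) (κ : Fin 4), ‖((gaugeAct u V x κ : (Matrix n n ℂ)ˣ) : Matrix n n ℂ) - (F x κ : Matrix n n ℂ)‖ ≤ ρ) →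
            (N : ℝ) * γ / (8 * Real.pi) ≤ ρ := by
  obtain ⟨i₀⟩ := ‹Nonempty n›
  have hN1 : 1 ≤ N := le_trans (by norm_num) hN
  set m : ℕ := N / 2 with hm
  -- the profile, the phases, the configuration
  let a : ℤ → ℤ := fun j => ((N / 2 : ℕ) : ℤ) - |j % (N : ℤ) - ((N / 2 : ℕ) : ℤ)|
  have ha : ∀ j : ℤ, a j = ((N / 2 : ℕ) : ℤ) - |j % (N : ℤ) - ((N / 2 : ℕ) : ℤ)| := fun _ => rfl
  let θ : Site 4 → Fin 4 → ℝ := fun x μ => if μ = 0 then γ * ((a (x 1) : ℤ) : ℝ) else 0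
  have hθ0 : ∀ x : Site 4, θ x 0 = γ * ((a (x 1) : ℤ) : ℝ) := fun x => by simp [θ]
  have hθ : ∀ (x : Site 4) (μ : Fin 4), μ ≠ 0 → θ x μ = 0 := fun x μ hμ => by simp [θ, hμ]
  let U : Site 4 → Fin 4 → (Matrix n n ℂ)ˣ := fun x μ =>
    ⟨Matrix.diagonal (Function.update (1 : n → ℂ) i₀ (cexp (I * θ x μ))),
      Matrix.diagonal (Function.update (1 : n → ℂ) i₀ (cexp (I * θ x μ))⁻¹),
      by rw [phaseMat_mul, mul_inv_cancel₀ (Complex.exp_ne_zero _), phaseMat_one],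
      by rw [phaseMat_mul, inv_mul_cancel₀ (Complex.exp_ne_zero _), phaseMat_one]⟩
  have hU : ∀ x μ, ((U x μ : (Matrix n n ℂ)ˣ) : Matrix n n ℂ) = Matrix.diagonal (Function.update (1 : n → ℂ) i₀ (cexp (I * θ x μ))) :=
    fun _ _ => rfl
  have hUu : IsUnitaryCfg U := isUnitaryCfg_of_phaseCfg hU
  -- sizes of `m = ⌊N∕2⌋`
  have hmN : (m : ℝ) ≤ (N : ℝ) / 2 := by
    have h := Nat.div_mul_le_self N 2
    have h' : ((N / 2 : ℕ) : ℝ) * 2 ≤ (N : ℝ) := by exact_mod_cast h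
    rw [hm]; linarith
  have hNm : (N : ℝ) ≤ 4 * (m : ℝ) := by
    have h := Nat.lt_succ_of_le (Nat.div_mul_le_self N 2)
    have h' : (N : ℝ) < ((N / 2 : ℕ) : ℝ) * 2 + 2 := by
      have := Nat.lt_div_mul_add (a := N) (b := 2) (by norm_num)
      exact_mod_cast (by omega : N < N / 2 * 2 + 2)
    have hm1 : (1 : ℝ) ≤ ((N / 2 : ℕ) : ℝ) := by exact_mod_cast Nat.div_pos hN (by norm_num)
    rw [hm]; linarith
  have hm0 : (0 : ℝ) ≤ m := by positivity
  have hγm : γ * (m : ℝ) * (m : ℝ) ≤ Real.pi := by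
    have h1 : γ * (m : ℝ) * (m : ℝ) ≤ γ * ((N : ℝ) / 2) * ((N : ℝ) / 2) := by
      have := mul_le_mul hmN hmN hm0 (by positivity)
      nlinarith
    have h2 : γ * ((N : ℝ) / 2) * ((N : ℝ) / 2) = (N : ℝ) ^ 2 * γ / 4 := by ring
    linarith
  refine ⟨U, hUu, isPeriodicCfg_of_profile hθ0 hθ hU (triangle_periodic ha),
    smallField_of_profile hθ0 hθ hU hγ (triangle_step ha hN1), fun x κ => ?_, fun F hFu hflat u hu ρ hρ => ?_⟩
  · refine (norm_bond_sub_one_le_of_profile hθ0 hθ hU hγ (abs_triangle_le ha hN1) x κ).trans ?_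
    rw [mul_comm]
    exact mul_le_mul_of_nonneg_right hmN hγ
  · -- the loop letter on the rectangle of perimeter `4m`
    set w : List (Letter 4) := List.replicate m ((0 : Fin 4), true) ++ List.replicate m ((1 : Fin 4), true)
        ++ List.replicate m ((0 : Fin 4), false) ++ List.replicate m ((1 : Fin 4), false) with hw
    have hdisp : disp w = 0 := by
      simp only [hw, disp_append, disp_replicate, Letter.vec_true, Letter.vec_false, smul_neg]
      abel
    have hlen : (w.length : ℝ) = 4 * (m : ℝ) := by
      simp only [hw, List.length_append, List.length_replicate]
      push_cast; ring
    have hup := norm_hol_sub_one_le_of_near_flat hUu hFu hflat hu hρ 0 hdisp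
    have hlow := norm_hol_rectangle_sub_one_ge hθ0 hθ hU (triangle_zero ha) (triangle_mid ha hN) hγ hγm
    rw [hlen] at hup
    have hρ0 : 0 ≤ ρ := le_trans (norm_nonneg _) (hρ 0 0)
    -- `(2/π) γ m² ≤ 4 m ρ`, `N ≤ 4m`
    have hpi := Real.pi_pos
    have key : 2 / Real.pi * (γ * (m : ℝ) * (m : ℝ)) ≤ 4 * (m : ℝ) * ρ := hlow.trans hup
    rw [div_le_iff₀ (by positivity)]
    have hm1 : (1 : ℝ) ≤ (m : ℝ) := by exact_mod_cast Nat.div_pos hN (by norm_num)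
    -- divide by `m ≥ 1`
    have key' : 2 * (γ * (m : ℝ) * (m : ℝ)) ≤ Real.pi * (4 * (m : ℝ) * ρ) := by
      have := mul_le_mul_of_nonneg_left key hpi.le
      rwa [← mul_assoc, mul_div_cancel₀ _ hpi.ne'] at this
    have key'' : γ * (m : ℝ) ≤ 2 * Real.pi * ρ := by
      have hmpos : (0 : ℝ) < m := by linarith
      nlinarith
    nlinarith [mul_le_mul_of_nonneg_left hNm hγ]

end Witness


end

end Summit.QuantumFields.BalabanUV.T4Continuum.NE7NearFlatSharpAbelian
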